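import Literature.MathematicalPhysics.QuantumFieldTheory.Balaban1983to89.T4CubeShellBlocks

/-!
# `Balaban1983to89.T4CubeShellResponseStein` — SHELL CONDITIONING OF THE WINDOWED GIBBS LAW ON A CUBE, III: differentiation
# under `∫_K` ([Durrett2019] Thm A.5.3); the RESPONSE OF THE CONDITIONAL MEAN `∂_(x_j) E[F | x_shell] = E[∂_jF | x_shell] −
# Cov(F, ∂_j f | x_shell)` and `d/dt ⟨Φ⟩_(f₀+tW) = −Cov(Φ,W)` ([GlimmJaffe1987] Cor. 4.3.4, proof: `d⟨ξ_j⟩∕dh_i = ⟨ξ_iξ_j⟩ −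
# ⟨ξ_i⟩⟨ξ_j⟩`; [FriedliVelenik2017] Lemma 3.31, proof); the third cumulant and the COVARIANCE INTERPOLATION FORMULA
# `d/dt Cov_(f₀+tW)(F,H) = −κ₃(F,H,W)` ([GlimmJaffe1987] §4.3, Remark after Cor. 4.3.4: Ursell functions `U(i₁,…,i_ν) =
# ∂^ν ln Z ∕ ∂h_(i₁)⋯∂h_(i_ν)`, `ν = 3`); and INTEGRATION BY PARTS WITH FACES on the cube (Stein's identity for `e^(−f) 1_K dx` —
# the windowed finite-dimensional form of [GlimmJaffe1987] (9.1.32); faces by Stokes on the singular cube, [Spivak1965] Thm 4-13)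

statement-and-proof file: textbook calculus ∕ probability on the tree's cube model, every public declaration cite-tagged; nothing
here is a claim about the Yang–Mills mass gap

CITATION HEADER (lean-in-tree rule).  Ideation cell `ym-nodeO-ideate` (portfolio track), seat P8 «dual witness for the
β-interval bounds», memo `memos/ROUTE-p8.md` (v7.0 sha256 3f529b57…, referee REF g47 PASS 2026-08-27; v7.1 §72 records this
edition).  LANDING EDITION (generation 10), module III of 3 («CubeShell I–III») of the memo companion
`memos/ROUTE-p8-SketchG7.lean` («G7», sha256 ee65fa81…, 1229 l., 65 declarations, 0 `sorry`, 0 `axiom`; REF g47 farm replication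
rc 0, axioms standard): G7 §4 :488–:633 (the `D3` section, whole); from G7 §6 :761–:970 the declarations `cubeCum3`,
`setIntegral_centred_mul3`, `cubeCum3_eq`, `hasDerivAt_cubeMean_tilt`, `hasDerivAt_cubeCov_tilt` (the other two of G7 §6 sit in
module I); G7 §5 :637–:757 (the `Stein` section, whole); G7 §7 :974–:1019 (two seam lemmas `abs_cubeCov_le_of_markov`,
`gradSq_le_card_mul_sq`: memo-side glue — a one-line corollary of module I's `abs_cubeCov_le` and an elementary sum bound) is
CUT from the edition.  Statements and proof terms are CHARACTER-IDENTICAL to G7's; edition deltas = namespace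
(`YMNodeOIdeate.P8g7` → this module's), this header, the three-module split with imports, per-declaration cite tags replacing
G7's bare folklore tags (each names the printed statement the declaration formalises or serves on the cube model; proofs ours),
one-line docstrings added to helpers G7 left bare, memo labels neutralised in docstrings; no `private` in this module.  LABELS
(memo-side words, NOT tree declarations): «(D1)»–«(D5)» = the five measure-side inputs of the memo's level-0 «conditioning ∕
scale-doubling» scheme for covariance decay of windowed Gibbs laws (a quadratic scale recursion `κ(2m) ≤ c·κ(m)² + η` fed by
Brascamp–Lieb on the window, shell conditioning and the response identity) — the scheme, its seed and its analytic inputs are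
NOT in the tree; labels `lab : Fin n → Fin 3`: `0` inside, `1` shell, `2` outside.

HONEST FRAMING.  Nothing here is printed in Bałaban's papers and nothing is asserted about his densities: every declaration is
[folklore] probability ∕ calculus — the cube-window, continuous-spin instance of the cited textbook statements — on the TREE's
Euclidean cube model of a one-step fluctuation fibre `Balaban1983to89.T4CubePoincare` (`cube n S = [-S,S]ⁿ`, `cubeMass`,
`cubeMean`, `cubeVar`, the windowed Gibbs law `μ_K ∝ e^{-f} 1_K dx`, the convexity input `HessianBound f λ`).

WHAT IS PROVED (no `sorry`, no new axiom; `#print axioms hasDerivAt_shellMean ∕ hasDerivAt_cubeCov_tilt ∕ stein_faces` standard).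
* §1 «(D3)» `hasDerivAt_setIntegral_cube`: differentiation under `∫_K` for a continuous parametric integrand with jointly
  continuous parameter-derivative on the compact cube (Mathlib `hasDerivAt_integral_of_dominated_loc_of_deriv_le`;
  [Durrett2019] Thm A.5.3), and **`hasDerivAt_shellMean`**: for `f, F ∈ C¹`, `0 < S` and a SHELL coordinate `j`,
  `t ↦ E[F | (x + t e_j)_shell]` has derivative `E[∂_jF | x_shell] − shellCov lab f S F (∂_j f) x` at `0` — the kernel-level,
  NONLINEAR-in-parameter form of the response identity (quotient rule on `shellMean = num ∕ shellMass`).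
* §2 «(D4)» `cubeCum3` (the joint third cumulant `κ₃(F,H,W)` of the windowed law), `setIntegral_centred_mul3`, `cubeCum3_eq`
  (`κ₃ = Cov(FH,W) − ⟨F⟩Cov(H,W) − ⟨H⟩Cov(F,W)`), **`hasDerivAt_cubeMean_tilt`** (`d/dt ⟨Φ⟩_(f₀+tW) |₀ = −Cov_(f₀)(Φ,W)`) and
  **`hasDerivAt_cubeCov_tilt`** (`d/dt Cov_(f₀+tW)(F,H) |₀ = −κ₃(F,H,W)`), all for continuous data on the cube.
* §3 «(D5)» **`stein_faces`**: on `[-S,S]^(n+1)`, `0 < S`, for `f, G ∈ C¹` and a coordinate `l`,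
  `∫_K ∂_lG·e^(−f) = ∫_K G·∂_l f·e^(−f) + ∫_(x_l = +S) G e^(−f) − ∫_(x_l = −S) G e^(−f)` (face integrals over `[-S,S]ⁿ` via
  `Fin.insertNth`): Mathlib's divergence theorem on boxes `integral_divergence_of_hasFDerivAt_off_countable'` with the
  one-component field `G e^(−f) · e_l`; the HARD window costs exactly two face integrals (no mollification of the window).

NEAREST TREE ∕ MATHLIB ITEMS (dedup census; nothing restated).  `T4CovarianceResponse.hasDerivAt_tiltMean` is the ABSTRACT
response identity for LINEAR tilts of a finite measure (`∫ Φ e^(tW) dμ ∕ ∫ e^(tW) dμ`); `hasDerivAt_cubeMean_tilt` is its twin on the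
`T4CubePoincare` set-integral carrier, kept separate because §1 needs the same computation with a NONLINEAR parameter
(`x ↦ f(merge lab x ·)`) over the same objects, which module II consumes by name; `T4PairResponseWindow` ∕ `T4ConvexResponse`
concern Bałaban's chart functional, not Gibbs means.  Cumulants elsewhere in the tree: `LatticeModels.UrsellInversion ∕
UrsellPartitionMoments` (ALL Ursell functions of an abstract moment map by Möbius inversion over set partitions, Ruelle 1969
§4.4.1) and `UrsellFourCurrents* ∕ UrsellMonotonicityTwo` (`u₄` of Ising spins); `cubeCum3` is the explicit `ν = 3` centred
moment of the cube law (for `ν ≤ 3` the Ursell function is the centred moment), typed directly because `hasDerivAt_cubeCov_tilt`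
differentiates it — no identification with `ursellOf` is stated or needed; no covariance-interpolation (`d/dt Cov`) statement
for a Gibbs ∕ tilted mean exists under `Literature/` (searched `rg -i "ursell|cumulant"`, `rg "hasDerivAt.*Cov"`).
`Literature.Analysis.Calculus.BoxStokes.integral_extDeriv_Icc_eq_sum_faces` is Stokes for `n`-FORMS on boxes ([Spivak1965]
Thm 4-13); `stein_faces` is the scalar integration-by-parts consequence against the Gibbs factor, obtained directly from
Mathlib's divergence theorem — as fourteen other tree files do (e.g. `Analysis.PDE.HalfBallDivergenceTheorem`) — rather than
through the forms API; `Probability.Moments.BrascampLiebVarianceProofs` integrates by parts on the whole space (no faces).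
Mathlib: `hasDerivAt_integral_of_dominated_loc_of_deriv_le`, `integral_prod`, `integral_divergence_of_hasFDerivAt_off_countable'`,
`Fin.insertNth`, `Continuous.integrableOn_Icc`.

CAVEATS ∕ NOT HERE.  (MODEL) the fibre is `ℝⁿ` with Lebesgue measure and a cube window, as in `T4CubePoincare`; Bałaban's
fibre is a product of group copies read in a chart — that TRANSPORT is not here.  (RAW) no integrability hypotheses (compact cube,
continuous integrands); `S > 0` wherever a mass is inverted.  NOT HERE: any decay statement, any log-Sobolev ∕ cumulant BOUND,
any Combes–Thomas seed, the scale-recursion certificate, balls instead of cubes, anything about Bałaban's densities, [B12]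
Theorem 2 or the cell's target `B13TermWalkDataOneTorus.ExistsUniformAcrossSmall`.  Value = kernel-checked measure-side identities
of the cube model, usable by name; NOT summit progress; no YM-PLAN ∕ Track-B node is claimed closed.  NEW file, imports built tree
modules only (and the earlier modules of this series); nothing modified; dimension-generic; net new unproved facts: 0.
[cite: GlimmJaffe1987, Cor. 4.3.4 (proof), §4.3 Remark after Cor. 4.3.4, (9.1.32); FriedliVelenik2017, Lemma 3.31 (proof); Durrett2019, Thm A.5.3; Spivak1965, Thm 4-13] -/

set_option autoImplicit false

open MeasureTheory Set
open scoped Topology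

namespace Literature.MathematicalPhysics.QuantumFieldTheory.Balaban1983to89.T4CubeShellResponseStein

open Literature.MathematicalPhysics.QuantumFieldTheory.Balaban1983to89.T4CubePoincare
open Literature.MathematicalPhysics.QuantumFieldTheory.Balaban1983to89.T4CubeShellBlocks
open Literature.Probability.Distributions

variable {n : ℕ}

/-! ## §1 «(D3)» differentiation under `∫_K` and the shell response identity -/

section D3

/-- **Differentiation under `∫_K dz` (PROVED).**  A parameter-dependent continuous integrand on the cube whose
parameter-derivative exists everywhere and is JOINTLY continuous may be differentiated under the integral sign
(`hasDerivAt_integral_of_dominated_loc_of_deriv_le`, the dominating constant supplied by compactness of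
`[t₀−1, t₀+1] × K`; joint continuity stated on `ℝ × ℝⁿ`). [cite: Durrett2019, Thm A.5.3] -/
theorem hasDerivAt_setIntegral_cube {S : ℝ} {Φ Φ' : ℝ → (Fin n → ℝ) → ℝ} (hΦ : ∀ t, Continuous (Φ t))
    (hΦ' : Continuous fun p : ℝ × (Fin n → ℝ) => Φ' p.1 p.2)
    (hd : ∀ t z, HasDerivAt (fun s => Φ s z) (Φ' t z) t) (t₀ : ℝ) :
    HasDerivAt (fun t => ∫ z in cube n S, Φ t z) (∫ z in cube n S, Φ' t₀ z) t₀ := by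
  have hK : IsCompact (cube n S) := isCompact_cube n S
  haveI : IsFiniteMeasure (volume.restrict (cube n S)) := isFiniteMeasure_restrict.2 hK.measure_lt_top.ne
  have hI : IsCompact (Set.Icc (t₀ - 1) (t₀ + 1) ×ˢ cube n S) := isCompact_Icc.prod hK
  obtain ⟨C, hC⟩ := hI.exists_bound_of_continuousOn hΦ'.continuousOn
  have hs : Set.Icc (t₀ - 1) (t₀ + 1) ∈ 𝓝 t₀ := Icc_mem_nhds (by linarith) (by linarith)
  have hΦ't : ∀ t, Continuous (Φ' t) := fun t =>
    hΦ'.comp ((continuous_const : Continuous fun _ : Fin n → ℝ => t).prodMk continuous_id)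
  refine (hasDerivAt_integral_of_dominated_loc_of_deriv_le (μ := volume.restrict (cube n S))
    (F := Φ) (F' := Φ') (bound := fun _ => C) hs ?_ ?_ ?_ ?_ ?_ ?_).2
  · exact Filter.Eventually.of_forall fun t => (hΦ t).aestronglyMeasurable
  · exact integrableOn_cube' (hΦ t₀) S
  · exact (hΦ't t₀).aestronglyMeasurable
  · rw [ae_restrict_iff' (measurableSet_cube' n S)]
    exact Filter.Eventually.of_forall fun z hz t ht => hC (t, z) (Set.mk_mem_prod ht hz)
  · exact integrable_const C
  · exact Filter.Eventually.of_forall fun z t _ => hd t z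

/-- **(D3) RESPONSE IDENTITY FOR THE CONDITIONAL MEAN (PROVED).**  For `f₁, F ∈ C¹` and a SHELL coordinate `j`
(`lab j = 1`): `∂_{x_j} E[F | x_shell] = E[∂_j F | x_shell] − Cov(F, ∂_j f₁ | x_shell)` — a covariance at HALF the
distance inside the shell (the recursion step of the scale-doubling scheme of the module docstring).  Proof: numerator and mass differentiated under
`∫_K` by `hasDerivAt_setIntegral_cube` (chain rule along `t ↦ merge lab x z + t•e_j`, `merge_add_smul_single`),
then the quotient rule — the nonlinear-parameter analogue of `T4CovarianceResponse.hasDerivAt_tiltMean` (tree,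
LINEAR tilts). [cite: GlimmJaffe1987, Cor. 4.3.4 (proof); FriedliVelenik2017, Lemma 3.31 (proof); Durrett2019, Thm A.5.3] -/
theorem hasDerivAt_shellMean {S : ℝ} (hS : 0 < S) (lab : Fin n → Fin 3) {f₁ F : (Fin n → ℝ) → ℝ}
    (hf₁ : ContDiff ℝ 1 f₁) (hF : ContDiff ℝ 1 F) (x : Fin n → ℝ) {j : Fin n} (hj : lab j = 1) :
    HasDerivAt (fun t : ℝ => shellMean lab f₁ S F (x + t • Pi.single j 1))
      (shellMean lab f₁ S (fun y => coordGradient F y j) x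
        - shellCov lab f₁ S F (fun y => coordGradient f₁ y j) x) 0 := by
  have hFd : Differentiable ℝ F := hF.differentiable one_ne_zero
  have hfd : Differentiable ℝ f₁ := hf₁.differentiable one_ne_zero
  have hFc : Continuous F := hF.continuous
  have hEc : Continuous fun y => Real.exp (-f₁ y) := continuous_expNeg hf₁.continuous
  have hgF : Continuous fun y => coordGradient F y j := (continuous_apply j).comp (continuous_coordGradient hF)
  have hgf : Continuous fun y => coordGradient f₁ y j := (continuous_apply j).comp (continuous_coordGradient hf₁)
  -- the path `t ↦ merge lab x z + t•e_j` (= `merge lab (x + t•e_j) z` by `merge_add_smul_single`)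
  have hqc : Continuous fun p : ℝ × (Fin n → ℝ) => merge lab x p.2 + p.1 • (Pi.single j 1 : Fin n → ℝ) :=
    ((continuous_merge_right lab x).comp continuous_snd).add (continuous_fst.smul continuous_const)
  have hqz : ∀ t : ℝ, Continuous fun z : Fin n → ℝ => merge lab x z + t • (Pi.single j 1 : Fin n → ℝ) :=
    fun t => (continuous_merge_right lab x).add continuous_const
  have hpath : ∀ (z : Fin n → ℝ) (t : ℝ),
      HasDerivAt (fun s : ℝ => merge lab x z + s • (Pi.single j 1 : Fin n → ℝ)) (Pi.single j 1) t := by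
    intro z t
    have h := ((hasDerivAt_id' t).smul_const (Pi.single j 1 : Fin n → ℝ)).const_add (merge lab x z)
    simpa using h
  -- pointwise derivatives of the two integrands
  have hdN : ∀ (t : ℝ) (z : Fin n → ℝ), HasDerivAt
      (fun s : ℝ => F (merge lab x z + s • Pi.single j 1) * Real.exp (-f₁ (merge lab x z + s • Pi.single j 1)))
      ((coordGradient F (merge lab x z + t • Pi.single j 1) j
        - F (merge lab x z + t • Pi.single j 1) * coordGradient f₁ (merge lab x z + t • Pi.single j 1) j)
        * Real.exp (-f₁ (merge lab x z + t • Pi.single j 1))) t := by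
    intro t z
    have h1 : HasDerivAt (fun s : ℝ => F (merge lab x z + s • Pi.single j 1))
        (fderiv ℝ F (merge lab x z + t • Pi.single j 1) (Pi.single j 1)) t :=
      (hFd (merge lab x z + t • Pi.single j 1)).hasFDerivAt.comp_hasDerivAt t (hpath z t)
    have hE : HasFDerivAt (fun y => Real.exp (-f₁ y))
        (Real.exp (-f₁ (merge lab x z + t • Pi.single j 1)) •
          (-(fderiv ℝ f₁ (merge lab x z + t • Pi.single j 1)))) (merge lab x z + t • Pi.single j 1) :=
      (hfd (merge lab x z + t • Pi.single j 1)).hasFDerivAt.neg.exp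
    have h2 := hE.comp_hasDerivAt t (hpath z t)
    refine (h1.mul h2).congr_deriv ?_
    simp only [Function.comp_apply, _root_.smul_apply, _root_.neg_apply, smul_eq_mul, coordGradient]
    ring
  have hdZ : ∀ (t : ℝ) (z : Fin n → ℝ), HasDerivAt
      (fun s : ℝ => Real.exp (-f₁ (merge lab x z + s • Pi.single j 1)))
      (-(coordGradient f₁ (merge lab x z + t • Pi.single j 1) j
        * Real.exp (-f₁ (merge lab x z + t • Pi.single j 1)))) t := by
    intro t z
    have hE : HasFDerivAt (fun y => Real.exp (-f₁ y))
        (Real.exp (-f₁ (merge lab x z + t • Pi.single j 1)) •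
          (-(fderiv ℝ f₁ (merge lab x z + t • Pi.single j 1)))) (merge lab x z + t • Pi.single j 1) :=
      (hfd (merge lab x z + t • Pi.single j 1)).hasFDerivAt.neg.exp
    have h2 := hE.comp_hasDerivAt t (hpath z t)
    refine h2.congr_deriv ?_
    simp only [_root_.smul_apply, _root_.neg_apply, smul_eq_mul, coordGradient]
    ring
  -- continuity of the integrands (in `z`) and of their parameter-derivatives (jointly in `(t, z)`)
  have hcN : ∀ t : ℝ, Continuous fun z : Fin n → ℝ =>
      F (merge lab x z + t • Pi.single j 1) * Real.exp (-f₁ (merge lab x z + t • Pi.single j 1)) :=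
    fun t => (hFc.comp (hqz t)).mul (hEc.comp (hqz t))
  have hcN' : Continuous fun p : ℝ × (Fin n → ℝ) =>
      (coordGradient F (merge lab x p.2 + p.1 • Pi.single j 1) j
        - F (merge lab x p.2 + p.1 • Pi.single j 1) * coordGradient f₁ (merge lab x p.2 + p.1 • Pi.single j 1) j)
        * Real.exp (-f₁ (merge lab x p.2 + p.1 • Pi.single j 1)) :=
    ((hgF.comp hqc).sub ((hFc.comp hqc).mul (hgf.comp hqc))).mul (hEc.comp hqc)
  have hcZ : ∀ t : ℝ, Continuous fun z : Fin n → ℝ => Real.exp (-f₁ (merge lab x z + t • Pi.single j 1)) :=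
    fun t => hEc.comp (hqz t)
  have hcZ' : Continuous fun p : ℝ × (Fin n → ℝ) =>
      -(coordGradient f₁ (merge lab x p.2 + p.1 • Pi.single j 1) j
        * Real.exp (-f₁ (merge lab x p.2 + p.1 • Pi.single j 1))) :=
    ((hgf.comp hqc).mul (hEc.comp hqc)).neg
  -- differentiate numerator and mass under the integral sign
  have hN := hasDerivAt_setIntegral_cube (S := S)
    (Φ := fun t z => F (merge lab x z + t • Pi.single j 1) * Real.exp (-f₁ (merge lab x z + t • Pi.single j 1)))
    (Φ' := fun t z => (coordGradient F (merge lab x z + t • Pi.single j 1) j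
        - F (merge lab x z + t • Pi.single j 1) * coordGradient f₁ (merge lab x z + t • Pi.single j 1) j)
        * Real.exp (-f₁ (merge lab x z + t • Pi.single j 1)))
    hcN hcN' hdN 0
  have hZ := hasDerivAt_setIntegral_cube (S := S)
    (Φ := fun t z => Real.exp (-f₁ (merge lab x z + t • Pi.single j 1)))
    (Φ' := fun t z => -(coordGradient f₁ (merge lab x z + t • Pi.single j 1) j
        * Real.exp (-f₁ (merge lab x z + t • Pi.single j 1))))
    hcZ hcZ' hdZ 0
  simp only [zero_smul, add_zero] at hN hZ
  have hZ0 : 0 < ∫ z in cube n S, Real.exp (-f₁ (merge lab x z)) := shellMass_pos lab hf₁.continuous hS x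
  have hZne : (∫ z in cube n S, Real.exp (-f₁ (merge lab x z))) ≠ 0 := hZ0.ne'
  have key := hN.div hZ (by simpa using hZne)
  -- identify the function being differentiated
  have hfun : (fun t : ℝ => shellMean lab f₁ S F (x + t • Pi.single j 1)) = fun t =>
      (∫ z in cube n S, F (merge lab x z + t • Pi.single j 1) * Real.exp (-f₁ (merge lab x z + t • Pi.single j 1))) /
        ∫ z in cube n S, Real.exp (-f₁ (merge lab x z + t • Pi.single j 1)) := by
    funext t
    simp only [shellMean, shellMass, merge_add_smul_single hj]
  rw [hfun]
  refine key.congr_deriv ?_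
  simp only [zero_smul, add_zero]
  -- split the numerator derivative and finish with algebra
  have hm : Continuous (merge lab x) := continuous_merge_right lab x
  have iA : IntegrableOn (fun z => coordGradient F (merge lab x z) j * Real.exp (-f₁ (merge lab x z)))
      (cube n S) volume := integrableOn_cube' ((hgF.comp hm).mul (hEc.comp hm)) S
  have iB : IntegrableOn
      (fun z => F (merge lab x z) * coordGradient f₁ (merge lab x z) j * Real.exp (-f₁ (merge lab x z)))
      (cube n S) volume := integrableOn_cube' (((hFc.comp hm).mul (hgf.comp hm)).mul (hEc.comp hm)) S
  have hsplit : (∫ z in cube n S, (coordGradient F (merge lab x z) j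
        - F (merge lab x z) * coordGradient f₁ (merge lab x z) j) * Real.exp (-f₁ (merge lab x z))) =
      (∫ z in cube n S, coordGradient F (merge lab x z) j * Real.exp (-f₁ (merge lab x z))) -
        ∫ z in cube n S, F (merge lab x z) * coordGradient f₁ (merge lab x z) j * Real.exp (-f₁ (merge lab x z)) := by
    rw [← integral_sub iA iB]
    congr 1
    funext z
    ring
  rw [hsplit, integral_neg]
  simp only [shellMean, shellCov, shellMass]
  field_simp
  ring

end D3

/-! ## §2 «(D4)» the third cumulant and the covariance interpolation formula `d/dt Cov_(f₀ + tW)(F,H) = −κ₃(F,H,W)` -/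

section D4

/-- The joint third cumulant `κ₃(F,H,W) = E_K[(F − ⟨F⟩)(H − ⟨H⟩)(W − ⟨W⟩)]` of the windowed Gibbs law. [cite: GlimmJaffe1987, §4.3 Remark after Cor. 4.3.4] -/
noncomputable def cubeCum3 (f : (Fin n → ℝ) → ℝ) (S : ℝ) (F H W : (Fin n → ℝ) → ℝ) : ℝ :=
  cubeMean f S fun x => (F x - cubeMean f S F) * (H x - cubeMean f S H) * (W x - cubeMean f S W)

/-- Raw-moment expansion of a centred triple product on the cube. [cite: GlimmJaffe1987, §4.3 Remark after Cor. 4.3.4] -/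
theorem setIntegral_centred_mul3 {f F H W : (Fin n → ℝ) → ℝ} (hf : Continuous f) (hF : Continuous F)
    (hH : Continuous H) (hW : Continuous W) (S a b c : ℝ) :
    ∫ x in cube n S, (F x - a) * (H x - b) * (W x - c) * Real.exp (-f x) =
      (∫ x in cube n S, F x * H x * W x * Real.exp (-f x))
        - c * (∫ x in cube n S, F x * H x * Real.exp (-f x))
        - b * (∫ x in cube n S, F x * W x * Real.exp (-f x))
        - a * (∫ x in cube n S, H x * W x * Real.exp (-f x))
        + b * c * (∫ x in cube n S, F x * Real.exp (-f x))
        + a * c * (∫ x in cube n S, H x * Real.exp (-f x))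
        + a * b * (∫ x in cube n S, W x * Real.exp (-f x))
        - a * b * c * ∫ x in cube n S, Real.exp (-f x) := by
  have hE : Continuous fun x => Real.exp (-f x) := continuous_expNeg hf
  have i1 : IntegrableOn (fun x => F x * H x * W x * Real.exp (-f x)) (cube n S) volume :=
    integrableOn_cube' (((hF.mul hH).mul hW).mul hE) S
  have i2 : IntegrableOn (fun x => c * (F x * H x * Real.exp (-f x))) (cube n S) volume :=
    (integrableOn_cube' ((hF.mul hH).mul hE) S).const_mul c
  have i3 : IntegrableOn (fun x => b * (F x * W x * Real.exp (-f x))) (cube n S) volume :=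
    (integrableOn_cube' ((hF.mul hW).mul hE) S).const_mul b
  have i4 : IntegrableOn (fun x => a * (H x * W x * Real.exp (-f x))) (cube n S) volume :=
    (integrableOn_cube' ((hH.mul hW).mul hE) S).const_mul a
  have i5 : IntegrableOn (fun x => b * c * (F x * Real.exp (-f x))) (cube n S) volume :=
    (integrableOn_cube' (hF.mul hE) S).const_mul (b * c)
  have i6 : IntegrableOn (fun x => a * c * (H x * Real.exp (-f x))) (cube n S) volume :=
    (integrableOn_cube' (hH.mul hE) S).const_mul (a * c)
  have i7 : IntegrableOn (fun x => a * b * (W x * Real.exp (-f x))) (cube n S) volume :=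
    (integrableOn_cube' (hW.mul hE) S).const_mul (a * b)
  have i8 : IntegrableOn (fun x => a * b * c * Real.exp (-f x)) (cube n S) volume :=
    (integrableOn_cube' hE S).const_mul (a * b * c)
  have s1 : IntegrableOn (fun x => F x * H x * W x * Real.exp (-f x) - c * (F x * H x * Real.exp (-f x)))
      (cube n S) volume := i1.sub i2
  have s2 : IntegrableOn (fun x => F x * H x * W x * Real.exp (-f x) - c * (F x * H x * Real.exp (-f x))
      - b * (F x * W x * Real.exp (-f x))) (cube n S) volume := s1.sub i3
  have s3 : IntegrableOn (fun x => F x * H x * W x * Real.exp (-f x) - c * (F x * H x * Real.exp (-f x))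
      - b * (F x * W x * Real.exp (-f x)) - a * (H x * W x * Real.exp (-f x))) (cube n S) volume := s2.sub i4
  have s4 : IntegrableOn (fun x => F x * H x * W x * Real.exp (-f x) - c * (F x * H x * Real.exp (-f x))
      - b * (F x * W x * Real.exp (-f x)) - a * (H x * W x * Real.exp (-f x))
      + b * c * (F x * Real.exp (-f x))) (cube n S) volume := s3.add i5
  have s5 : IntegrableOn (fun x => F x * H x * W x * Real.exp (-f x) - c * (F x * H x * Real.exp (-f x))
      - b * (F x * W x * Real.exp (-f x)) - a * (H x * W x * Real.exp (-f x))
      + b * c * (F x * Real.exp (-f x)) + a * c * (H x * Real.exp (-f x))) (cube n S) volume := s4.add i6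
  have s6 : IntegrableOn (fun x => F x * H x * W x * Real.exp (-f x) - c * (F x * H x * Real.exp (-f x))
      - b * (F x * W x * Real.exp (-f x)) - a * (H x * W x * Real.exp (-f x))
      + b * c * (F x * Real.exp (-f x)) + a * c * (H x * Real.exp (-f x))
      + a * b * (W x * Real.exp (-f x))) (cube n S) volume := s5.add i7
  have hpt : (fun x => (F x - a) * (H x - b) * (W x - c) * Real.exp (-f x)) = fun x =>
      F x * H x * W x * Real.exp (-f x) - c * (F x * H x * Real.exp (-f x)) - b * (F x * W x * Real.exp (-f x))
        - a * (H x * W x * Real.exp (-f x)) + b * c * (F x * Real.exp (-f x)) + a * c * (H x * Real.exp (-f x))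
        + a * b * (W x * Real.exp (-f x)) - a * b * c * Real.exp (-f x) := funext fun x => by ring
  rw [hpt, integral_sub s6 i8, integral_add s5 i7, integral_add s4 i6, integral_add s3 i5, integral_sub s2 i4,
    integral_sub s1 i3, integral_sub i1 i2,
    integral_const_mul, integral_const_mul, integral_const_mul, integral_const_mul, integral_const_mul,
    integral_const_mul, integral_const_mul]

/-- The third cumulant through covariances: `κ₃(F,H,W) = Cov(FH,W) − ⟨F⟩Cov(H,W) − ⟨H⟩Cov(F,W)` (PROVED).
[cite: GlimmJaffe1987, §4.3 Remark after Cor. 4.3.4] -/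
theorem cubeCum3_eq {S : ℝ} (hS : 0 < S) {f F H W : (Fin n → ℝ) → ℝ} (hf : Continuous f) (hF : Continuous F)
    (hH : Continuous H) (hW : Continuous W) :
    cubeCum3 f S F H W = cubeCov f S (fun x => F x * H x) W - cubeMean f S F * cubeCov f S H W
      - cubeMean f S H * cubeCov f S F W := by
  have hZ : cubeMass f S ≠ 0 := (cubeMass_pos hf hS).ne'
  have hFH : Continuous fun x : Fin n → ℝ => F x * H x := hF.mul hH
  simp only [cubeCum3, cubeCov, cubeMean]
  rw [setIntegral_centred_mul3 hf hF hH hW, setIntegral_centred_mul hf hFH hW,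
    setIntegral_centred_mul hf hH hW, setIntegral_centred_mul hf hF hW]
  rw [show (∫ x in cube n S, Real.exp (-f x)) = cubeMass f S from rfl]
  -- name the raw moments, then clear denominators
  generalize (∫ x in cube n S, F x * H x * W x * Real.exp (-f x)) = mFHW
  generalize (∫ x in cube n S, F x * H x * Real.exp (-f x)) = mFH
  generalize (∫ x in cube n S, F x * W x * Real.exp (-f x)) = mFW
  generalize (∫ x in cube n S, H x * W x * Real.exp (-f x)) = mHW
  generalize (∫ x in cube n S, F x * Real.exp (-f x)) = mF
  generalize (∫ x in cube n S, H x * Real.exp (-f x)) = mH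
  generalize (∫ x in cube n S, W x * Real.exp (-f x)) = mW
  generalize hZ' : cubeMass f S = Z at hZ ⊢
  field_simp
  ring

/-- **THE RESPONSE IDENTITY IN THE CUBE MODEL (PROVED).**  Along the linear tilt `f_t = f₀ + t·W` the cube mean of
a fixed continuous insert moves by minus its covariance with the tilt: `d/dt ⟨Φ⟩_{K,f_t} = −Cov_{K,f_t}(Φ, W)` — the
cube-model twin of `T4CovarianceResponse.hasDerivAt_tiltMean` (tree), obtained here from
`hasDerivAt_setIntegral_cube` and the quotient rule. [cite: GlimmJaffe1987, Cor. 4.3.4 (proof); FriedliVelenik2017, Lemma 3.31 (proof)] -/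
theorem hasDerivAt_cubeMean_tilt {S : ℝ} (hS : 0 < S) {f₀ W Φ : (Fin n → ℝ) → ℝ} (hf₀ : Continuous f₀)
    (hW : Continuous W) (hΦ : Continuous Φ) (t₀ : ℝ) :
    HasDerivAt (fun t : ℝ => cubeMean (fun x => f₀ x + t * W x) S Φ)
      (-cubeCov (fun x => f₀ x + t₀ * W x) S Φ W) t₀ := by
  -- pointwise derivatives of the weights
  have hdE : ∀ (t : ℝ) (x : Fin n → ℝ), HasDerivAt (fun s : ℝ => Real.exp (-(f₀ x + s * W x)))
      (-(W x * Real.exp (-(f₀ x + t * W x)))) t := by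
    intro t x
    have h0 : HasDerivAt (fun s : ℝ => f₀ x + s * W x) (W x) t := by
      simpa using ((hasDerivAt_id' t).mul_const (W x)).const_add (f₀ x)
    have h : HasDerivAt (fun s : ℝ => -(f₀ x + s * W x)) (-(W x)) t := h0.neg
    refine h.exp.congr_deriv ?_
    ring
  have hdN : ∀ (t : ℝ) (x : Fin n → ℝ), HasDerivAt (fun s : ℝ => Φ x * Real.exp (-(f₀ x + s * W x)))
      (-(Φ x * W x * Real.exp (-(f₀ x + t * W x)))) t := by
    intro t x
    refine ((hdE t x).const_mul (Φ x)).congr_deriv ?_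
    ring
  -- continuity
  have hlin : Continuous fun p : ℝ × (Fin n → ℝ) => -(f₀ p.2 + p.1 * W p.2) :=
    ((hf₀.comp continuous_snd).add (continuous_fst.mul (hW.comp continuous_snd))).neg
  have hE2 : Continuous fun p : ℝ × (Fin n → ℝ) => Real.exp (-(f₀ p.2 + p.1 * W p.2)) :=
    Real.continuous_exp.comp hlin
  have hEt : ∀ t : ℝ, Continuous fun x : Fin n → ℝ => Real.exp (-(f₀ x + t * W x)) :=
    fun t => Real.continuous_exp.comp ((hf₀.add (continuous_const.mul hW)).neg)
  have hcN : ∀ t : ℝ, Continuous fun x : Fin n → ℝ => Φ x * Real.exp (-(f₀ x + t * W x)) :=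
    fun t => hΦ.mul (hEt t)
  have hcN' : Continuous fun p : ℝ × (Fin n → ℝ) => -(Φ p.2 * W p.2 * Real.exp (-(f₀ p.2 + p.1 * W p.2))) :=
    (((hΦ.comp continuous_snd).mul (hW.comp continuous_snd)).mul hE2).neg
  have hcZ' : Continuous fun p : ℝ × (Fin n → ℝ) => -(W p.2 * Real.exp (-(f₀ p.2 + p.1 * W p.2))) :=
    ((hW.comp continuous_snd).mul hE2).neg
  have hN := hasDerivAt_setIntegral_cube (S := S) (Φ := fun t x => Φ x * Real.exp (-(f₀ x + t * W x)))
    (Φ' := fun t x => -(Φ x * W x * Real.exp (-(f₀ x + t * W x)))) hcN hcN' hdN t₀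
  have hZ := hasDerivAt_setIntegral_cube (S := S) (Φ := fun t x => Real.exp (-(f₀ x + t * W x)))
    (Φ' := fun t x => -(W x * Real.exp (-(f₀ x + t * W x)))) hEt hcZ' hdE t₀
  have hft₀ : Continuous fun x : Fin n → ℝ => f₀ x + t₀ * W x := hf₀.add (continuous_const.mul hW)
  have hΦW : Continuous fun x : Fin n → ℝ => Φ x * W x := hΦ.mul hW
  have hZpos : 0 < ∫ x in cube n S, Real.exp (-(f₀ x + t₀ * W x)) :=
    setIntegral_exp_neg_pos (f := fun x => f₀ x + t₀ * W x) hft₀ hS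
  have hZne : (∫ x in cube n S, Real.exp (-(f₀ x + t₀ * W x))) ≠ 0 := hZpos.ne'
  have key := hN.div hZ (by simpa using hZne)
  have hfun : (fun t : ℝ => cubeMean (fun x => f₀ x + t * W x) S Φ) = fun t =>
      (∫ x in cube n S, Φ x * Real.exp (-(f₀ x + t * W x))) / ∫ x in cube n S, Real.exp (-(f₀ x + t * W x)) := by
    funext t
    simp only [cubeMean, cubeMass]
  rw [hfun]
  refine key.congr_deriv ?_
  rw [cubeCov_eq_sub hS hft₀ hΦ hW]
  simp only [cubeMean, cubeMass, integral_neg]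
  generalize (∫ x in cube n S, Φ x * W x * Real.exp (-(f₀ x + t₀ * W x))) = mΦW
  generalize (∫ x in cube n S, Φ x * Real.exp (-(f₀ x + t₀ * W x))) = mΦ
  generalize (∫ x in cube n S, W x * Real.exp (-(f₀ x + t₀ * W x))) = mW
  generalize hZ' : (∫ x in cube n S, Real.exp (-(f₀ x + t₀ * W x))) = Z at hZne ⊢
  field_simp
  ring

/-- **(D4) COVARIANCE INTERPOLATION (PROVED).**  Along the linear interpolation of potentials `f_t = f₀ + t·W`
(e.g. `W` = the cross-shell part of a non-splitting action, `t ∈ [0,1]`), the cube covariance of two fixed inserts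
moves by minus the joint third cumulant: `d/dt Cov_{f_t}(F,H) = −κ₃^{(t)}(F,H,W)`.  With (D1) bounding `κ₃` this is
the additive quasi-Markov LEAK `η` of the scale-doubling scheme (module docstring).  Proof: `cubeCov_eq_sub`, three applications of
`hasDerivAt_cubeMean_tilt`, and `cubeCum3_eq`. [cite: GlimmJaffe1987, §4.3 Remark after Cor. 4.3.4] -/
theorem hasDerivAt_cubeCov_tilt {S : ℝ} (hS : 0 < S) {f₀ W F H : (Fin n → ℝ) → ℝ} (hf₀ : Continuous f₀)
    (hW : Continuous W) (hF : Continuous F) (hH : Continuous H) (t₀ : ℝ) :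
    HasDerivAt (fun t : ℝ => cubeCov (fun x => f₀ x + t * W x) S F H)
      (-cubeCum3 (fun x => f₀ x + t₀ * W x) S F H W) t₀ := by
  have hft : ∀ t : ℝ, Continuous fun x => f₀ x + t * W x := fun t => hf₀.add (continuous_const.mul hW)
  have hfun : (fun t : ℝ => cubeCov (fun x => f₀ x + t * W x) S F H) = fun t =>
      cubeMean (fun x => f₀ x + t * W x) S (fun x => F x * H x)
        - cubeMean (fun x => f₀ x + t * W x) S F * cubeMean (fun x => f₀ x + t * W x) S H := by
    funext t
    exact cubeCov_eq_sub hS (hft t) hF hH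
  rw [hfun]
  have hFH : Continuous fun x : Fin n → ℝ => F x * H x := hF.mul hH
  have h1 := hasDerivAt_cubeMean_tilt hS hf₀ hW hFH t₀
  have h2 := hasDerivAt_cubeMean_tilt hS hf₀ hW hF t₀
  have h3 := hasDerivAt_cubeMean_tilt hS hf₀ hW hH t₀
  refine (h1.sub (h2.mul h3)).congr_deriv ?_
  rw [cubeCum3_eq hS (hft t₀) hF hH hW]
  ring

end D4

/-! ## §3 «(D5)» Stein ∕ integration by parts with faces on the cube -/

section Stein

/-- **(D5) STEIN IDENTITY WITH FACE TERMS ON THE CUBE `[-S,S]^{n+1}` (PROVED).**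
`∫_K ∂_l G · e^{-f} = ∫_K G ∂_l f · e^{-f} + ∫_{face l = +S} G e^{-f} − ∫_{face l = −S} G e^{-f}` for `f, G ∈ C¹`:
the HARD window costs exactly two face integrals (no soft wall ∕ mollification of the window is needed).
Proof: Mathlib's divergence theorem on boxes `MeasureTheory.integral_divergence_of_hasFDerivAt_off_countable'` with
`a = −S·1 ≤ b = S·1`, the family `fᵢ := if i = l then G·e^{-f} else 0`, `s = ∅`; faces are parametrised by
`Fin.insertNth l (±S) : ℝⁿ → ℝⁿ⁺¹` over `cube n S` (`cube n S = Set.Icc (−S·1) (S·1)` by `Set.pi_univ_Icc`). [cite: GlimmJaffe1987, (9.1.32); Spivak1965, Thm 4-13] -/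
theorem stein_faces {S : ℝ} (hS : 0 < S) {f G : (Fin (n + 1) → ℝ) → ℝ} (hf : ContDiff ℝ 1 f)
    (hG : ContDiff ℝ 1 G) (l : Fin (n + 1)) :
    ∫ x in cube (n + 1) S, coordGradient G x l * Real.exp (-f x) =
      (∫ x in cube (n + 1) S, G x * coordGradient f x l * Real.exp (-f x))
        + ((∫ y in cube n S, G (Fin.insertNth l S y) * Real.exp (-f (Fin.insertNth l S y)))
          - ∫ y in cube n S, G (Fin.insertNth l (-S) y) * Real.exp (-f (Fin.insertNth l (-S) y))) := by
  -- the scalar field `φ = G e^{-f}` and its derivative as a continuous linear map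
  have hGd : Differentiable ℝ G := hG.differentiable one_ne_zero
  have hfd : Differentiable ℝ f := hf.differentiable one_ne_zero
  have hφc : Continuous fun x => G x * Real.exp (-f x) := hG.continuous.mul (continuous_expNeg hf.continuous)
  have hφD : ∀ x, HasFDerivAt (fun x => G x * Real.exp (-f x))
      (G x • (Real.exp (-f x) • (-(fderiv ℝ f x))) + Real.exp (-f x) • fderiv ℝ G x) x := fun x =>
    ((hGd x).hasFDerivAt).mul (((hfd x).hasFDerivAt).neg.exp)
  have hDe : ∀ x, (G x • (Real.exp (-f x) • (-(fderiv ℝ f x))) + Real.exp (-f x) • fderiv ℝ G x)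
      (Pi.single l 1) = coordGradient G x l * Real.exp (-f x) - G x * coordGradient f x l * Real.exp (-f x) := by
    intro x
    simp only [_root_.add_apply, _root_.smul_apply, _root_.neg_apply, smul_eq_mul, coordGradient]
    ring
  have hA : Continuous fun x => coordGradient G x l * Real.exp (-f x) :=
    ((continuous_apply l).comp (continuous_coordGradient hG)).mul (continuous_expNeg hf.continuous)
  have hB : Continuous fun x => G x * coordGradient f x l * Real.exp (-f x) :=
    (hG.continuous.mul ((continuous_apply l).comp (continuous_coordGradient hf))).mul
      (continuous_expNeg hf.continuous)
  -- the box `[-S,S]^{n+1}` and its faces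
  have hle : (fun _ : Fin (n + 1) => -S) ≤ (fun _ : Fin (n + 1) => S) := fun _ => by
    show -S ≤ S
    linarith
  have hK : cube (n + 1) S = Set.Icc (fun _ : Fin (n + 1) => -S) (fun _ : Fin (n + 1) => S) := by
    rw [cube, Set.pi_univ_Icc]
  have hface : Set.Icc ((fun _ : Fin (n + 1) => -S) ∘ l.succAbove) ((fun _ : Fin (n + 1) => S) ∘ l.succAbove) =
      cube n S := by
    rw [cube, Set.pi_univ_Icc]
    rfl
  -- the one-component family `famᵢ = δ_{il} φ`
  let fam : Fin (n + 1) → (Fin (n + 1) → ℝ) → ℝ := fun i x => if i = l then G x * Real.exp (-f x) else 0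
  let fam' : Fin (n + 1) → (Fin (n + 1) → ℝ) → (Fin (n + 1) → ℝ) →L[ℝ] ℝ := fun i x =>
    if i = l then G x • (Real.exp (-f x) • (-(fderiv ℝ f x))) + Real.exp (-f x) • fderiv ℝ G x else 0
  have Hc : ∀ i, ContinuousOn (fam i) (Set.Icc (fun _ : Fin (n + 1) => -S) (fun _ : Fin (n + 1) => S)) := by
    intro i
    by_cases hi : i = l
    · have : fam i = fun x => G x * Real.exp (-f x) := funext fun x => if_pos hi
      rw [this]
      exact hφc.continuousOn
    · have : fam i = fun _ => 0 := funext fun x => if_neg hi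
      rw [this]
      exact continuousOn_const
  have Hd : ∀ x ∈ (Set.pi Set.univ fun i => Set.Ioo ((fun _ : Fin (n + 1) => -S) i) ((fun _ : Fin (n + 1) => S) i))
      \ (∅ : Set (Fin (n + 1) → ℝ)), ∀ i, HasFDerivAt (fam i) (fam' i x) x := by
    intro x _ i
    by_cases hi : i = l
    · have h1 : fam i = fun x => G x * Real.exp (-f x) := funext fun x => if_pos hi
      have h2 : fam' i x = G x • (Real.exp (-f x) • (-(fderiv ℝ f x))) + Real.exp (-f x) • fderiv ℝ G x :=
        if_pos hi
      rw [h1, h2]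
      exact hφD x
    · have h1 : fam i = fun _ => 0 := funext fun x => if_neg hi
      have h2 : fam' i x = 0 := if_neg hi
      rw [h1, h2]
      exact hasFDerivAt_const 0 x
  have hsum : ∀ x, (∑ i, fam' i x (Pi.single i 1)) =
      coordGradient G x l * Real.exp (-f x) - G x * coordGradient f x l * Real.exp (-f x) := by
    intro x
    rw [Finset.sum_eq_single l]
    · have h2 : fam' l x = G x • (Real.exp (-f x) • (-(fderiv ℝ f x))) + Real.exp (-f x) • fderiv ℝ G x :=
        if_pos rfl
      rw [h2]
      exact hDe x
    · intro i _ hi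
      have h2 : fam' i x = 0 := if_neg hi
      rw [h2]
      rfl
    · intro h
      exact absurd (Finset.mem_univ l) h
  have Hi : IntegrableOn (fun x => ∑ i, fam' i x (Pi.single i 1))
      (Set.Icc (fun _ : Fin (n + 1) => -S) (fun _ : Fin (n + 1) => S)) := by
    have : (fun x => ∑ i, fam' i x (Pi.single i 1)) =
        fun x => coordGradient G x l * Real.exp (-f x) - G x * coordGradient f x l * Real.exp (-f x) :=
      funext hsum
    rw [this, ← hK]
    exact integrableOn_cube' (hA.sub hB) S
  have hdiv := MeasureTheory.integral_divergence_of_hasFDerivAt_off_countable' (fun _ : Fin (n + 1) => -S)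
    (fun _ : Fin (n + 1) => S) hle fam fam' ∅ Set.countable_empty Hc Hd Hi
  -- read the two sides
  have hL : (∫ x in Set.Icc (fun _ : Fin (n + 1) => -S) (fun _ : Fin (n + 1) => S), ∑ i, fam' i x (Pi.single i 1)) =
      (∫ x in cube (n + 1) S, coordGradient G x l * Real.exp (-f x)) -
        ∫ x in cube (n + 1) S, G x * coordGradient f x l * Real.exp (-f x) := by
    rw [← hK]
    rw [show (fun x => ∑ i, fam' i x (Pi.single i 1)) =
        fun x => coordGradient G x l * Real.exp (-f x) - G x * coordGradient f x l * Real.exp (-f x) from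
      funext hsum]
    exact integral_sub (integrableOn_cube' hA S) (integrableOn_cube' hB S)
  have hR : (∑ i : Fin (n + 1),
      ((∫ x in Set.Icc ((fun _ : Fin (n + 1) => -S) ∘ i.succAbove) ((fun _ : Fin (n + 1) => S) ∘ i.succAbove),
          fam i (i.insertNth ((fun _ : Fin (n + 1) => S) i) x)) -
        ∫ x in Set.Icc ((fun _ : Fin (n + 1) => -S) ∘ i.succAbove) ((fun _ : Fin (n + 1) => S) ∘ i.succAbove),
          fam i (i.insertNth ((fun _ : Fin (n + 1) => -S) i) x))) =
      (∫ y in cube n S, G (Fin.insertNth l S y) * Real.exp (-f (Fin.insertNth l S y))) -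
        ∫ y in cube n S, G (Fin.insertNth l (-S) y) * Real.exp (-f (Fin.insertNth l (-S) y)) := by
    rw [Finset.sum_eq_single l]
    · rw [hface]
      have h1 : ∀ y : Fin n → ℝ, ∀ c : ℝ, fam l (l.insertNth c y) =
          G (Fin.insertNth l c y) * Real.exp (-f (Fin.insertNth l c y)) := fun y c => if_pos rfl
      simp only [h1]
    · intro i _ hi
      have h1 : ∀ z : Fin (n + 1) → ℝ, fam i z = 0 := fun z => if_neg hi
      simp only [h1, integral_zero, sub_self]
    · intro h
      exact absurd (Finset.mem_univ l) h
  rw [hL, hR] at hdiv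
  rw [← hdiv]
  ring

end Stein

end Literature.MathematicalPhysics.QuantumFieldTheory.Balaban1983to89.T4CubeShellResponseStein
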